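import Mathlib
import Summits.NavierStokesRegularity.NavierStokesRegularity.Theorems.ThreadingFluxHorizonTowerDefs
import HarnessLib

/-!
# Route `ThreadingFlux` / `UnthreadedDoor`, crux `PoloidalLiouville` (stmt-NavierStokesRegularity-1222), WALL W1 —
# crux idea «horizon-threading-tower» (ns-idea-15): TYPED STATEMENTS for FINITE TOWERS AT ORDER ONE

Statements-only companion of the Defs twin `ThreadingFluxHorizonTowerDefs.lean` (that file is at its 400-line cap after the two-shell
and dipole-tower appends, so the finite-tower statements live here; same namespace `…Theorems.PoloidalLiouville.HorizonTower`, same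
vocabulary `E3`, `horizonProfile`, `horizonL1`, shaped exactly like `TwoShellHorizonTowerZonality` (Defs l.352) /
`DipoleTowerHorizonZonality` over `(K : Finset ℕ) (H : ℕ → E3 → ℝ)` as in `horizonL1_finiteTower`, p693759).  Typed at
ns-wall-crit-1 g5's price P4 (05:58:44Z): `D := K.max' _`, `D′ := (K.erase D).max' _`, the zonal FUNCTIONAL FORM of the top shell as
hypothesis of THM A, `Nat.Coprime D D′` + `H D, H D′ ≢ 0` for THM B; BC5 non-vacuity witness `K = {1, 2}`, `H 1 = z`,
`H 2 = 2z² − x² − y²`.  The theorems `finiteTowerZonalTopHorizonTowerZonality : FiniteTowerZonalTopHorizonTowerZonality` and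
`finiteTowerCoprimeTopHorizonTowerZonality : FiniteTowerCoprimeTopHorizonTowerZonality` live in
`Theorems/ThreadingFluxHorizonTowerFiniteTowerByName.lean` (width hand ns-wall-eng-3 g4).

HONEST LABEL: SPECIAL CASES (finite towers with a side condition on the top one or two shells, order one only) of the crux-idea
CONJECTURE `HorizonTowerZonality` (Defs l.261, which also spends `𝔏₂` and quantifies over all smooth profiles); no rung credit; the
general finite tower (top pair not coprime, top shell not known zonal), the general tower, `PoloidalLiouville` (1222),
`UnthreadedRigidity` (27585) and NS regularity stay OPEN; W1 movement 0.  `--supports stmt-NavierStokesRegularity-1222 --as helper`.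
[cite: MajdaBertozziCUP2002, §1.1 (vector identities)]
-/

noncomputable section

-- the summit and its single sub-problem share the name (CONVENTIONS §1)
set_option linter.dupNamespace false

namespace Summit.NavierStokesRegularity.NavierStokesRegularity.Theorems.PoloidalLiouville.HorizonTower

/-! ## Finite towers at order one (ns-wall-eng-3 g4; statements only) -/

/-- FINITE TOWERS WITH A ZONAL TOP SHELL ARE DECIDED AT ORDER ONE (THM A, zonal-top descent; THEOREM
`finiteTowerZonalTopHorizonTowerZonality`, file `Theorems/ThreadingFluxHorizonTowerFiniteTowerByName.lean`, closes it by name): a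
scale-free FINITE tower `U = Σ_{l∈K} U_{H_l}` (`U_H = horizonProfile · H 0`) of horizon profiles of smooth homogeneous harmonic shells
(`K ⊂ ℕ` finite and non-empty, degrees `l ≥ 1`, ANY number of shells, zero shells allowed) annihilated by the order-one horizon law
`𝔏₁` off the centre, whose TOP shell `H_D` (`D = max K`, `H_D ≢ 0`) has the zonal form about `a ≠ 0`, is COAXIALLY ZONAL about the SAME
axis `a` (axisymmetric without swirl).  Hypotheses in the vocabulary of `TwoShellHorizonTowerZonality`; the zonal functional form of
the top shell is equivalent to `⟪a × y, ∇H_D(y)⟫ ≡ 0` (`inner_cross_gradient_eq_zero_of_zonalForm` /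
`exists_zonalForm_of_inner_cross_gradient_eq_zero`). -/
def FiniteTowerZonalTopHorizonTowerZonality : Prop :=
  ∀ (K : Finset ℕ) (H : ℕ → E3 → ℝ) (hK : K.Nonempty) (a : E3), (∀ l ∈ K, 1 ≤ l) →
    (∀ l ∈ K, ContDiff ℝ (⊤ : ℕ∞) (H l)) → (∀ l ∈ K, ∀ (c : ℝ) (y : E3), H l (c • y) = c ^ l * H l y) →
    (∀ l ∈ K, ∀ y, Laplacian.laplacian (H l) y = 0) → (∃ y, H (K.max' hK) y ≠ 0) → a ≠ 0 →
    (∃ g : ℝ → ℝ, ∀ y : E3, y ≠ 0 → H (K.max' hK) y = ‖y‖ ^ (K.max' hK) * g (inner ℝ a y / ‖y‖)) →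
    (∀ x : E3, x ≠ 0 → horizonL1 (fun z => ∑ l ∈ K, horizonProfile l (H l) 0 z) 0 x = 0) →
    ∀ l ∈ K, ∃ g : ℝ → ℝ, ∀ y : E3, y ≠ 0 → H l y = ‖y‖ ^ l * g (inner ℝ a y / ‖y‖)

/-- FINITE TOWERS WITH COPRIME TOP DEGREES ARE DECIDED AT ORDER ONE (THM B, coprime top pair; THEOREM
`finiteTowerCoprimeTopHorizonTowerZonality`, file `Theorems/ThreadingFluxHorizonTowerFiniteTowerByName.lean`, closes it by name): a
scale-free finite tower of horizon profiles of smooth homogeneous harmonic shells (degrees `≥ 1`, at least two of them) annihilated by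
the order-one horizon law off the centre, whose two largest degrees `D = max K` and `D′ = max (K ∖ {D})` are COPRIME with `H_D, H_{D′} ≢ 0`,
is COAXIALLY ZONAL: one axis `a ≠ 0` gives every shell the zonal form.  Covers `{1,3,5}`, `{2,3,4}`, `{1,2,…,N}`, every tower with
consecutive top degrees; with `|K| = 2` it re-derives the COPRIME cells of `TwoShellHorizonTowerZonality` (p691920) only — the
non-coprime two-shell cells (e.g. degrees `2, 4`) are NOT recovered here (the two-shell theorem spends the bracket on all of `ℝ³`, this
statement only its null-cone trace). -/
def FiniteTowerCoprimeTopHorizonTowerZonality : Prop :=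
  ∀ (K : Finset ℕ) (H : ℕ → E3 → ℝ) (hK : K.Nonempty) (hK' : (K.erase (K.max' hK)).Nonempty), (∀ l ∈ K, 1 ≤ l) →
    (∀ l ∈ K, ContDiff ℝ (⊤ : ℕ∞) (H l)) → (∀ l ∈ K, ∀ (c : ℝ) (y : E3), H l (c • y) = c ^ l * H l y) →
    (∀ l ∈ K, ∀ y, Laplacian.laplacian (H l) y = 0) →
    (∃ y, H (K.max' hK) y ≠ 0) → (∃ y, H ((K.erase (K.max' hK)).max' hK') y ≠ 0) →
    Nat.Coprime (K.max' hK) ((K.erase (K.max' hK)).max' hK') →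
    (∀ x : E3, x ≠ 0 → horizonL1 (fun z => ∑ l ∈ K, horizonProfile l (H l) 0 z) 0 x = 0) →
    ∃ a : E3, a ≠ 0 ∧ ∀ l ∈ K, ∃ g : ℝ → ℝ, ∀ y : E3, y ≠ 0 → H l y = ‖y‖ ^ l * g (inner ℝ a y / ‖y‖)

/-! ## Finite towers at order one, II (ns-wall-eng-3 g4; statements only, appended): THM D (three shells of mixed parity) and THM C
(opposite-parity third shell) -/

/-- THREE-SHELL TOWERS OF MIXED PARITY ARE DECIDED AT ORDER ONE (THM D; THEOREM `threeShellMixedParityHorizonTowerZonality`, file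
`Theorems/ThreadingFluxHorizonTowerFiniteTowerByNameII.lean`, closes it by name; kernel theorem `threeShell_zonalForm_of_mixedParity`,
`…FiniteTowerThreeShell`): a scale-free three-shell tower `U_A + U_B + U_C`, `A ∈ 𝓗_l`, `B ∈ 𝓗_m`, `C ∈ 𝓗_n`, `1 ≤ l < m < n`, the
three degrees NOT all of one parity, all shells non-zero, annihilated by the order-one horizon law off the centre, is coaxially zonal.
Shaped exactly like `DipoleTowerHorizonZonality` (ARM A, Defs twin; the case `l = 1`) with `horizonProfile 1 A` replaced by
`horizonProfile l A` and `Even m ∨ Even n` by `¬(l ≡ m ≡ n mod 2)`; no coprimality is needed. -/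
def ThreeShellMixedParityHorizonTowerZonality : Prop :=
  ∀ (l m n : ℕ) (A B C : E3 → ℝ), 1 ≤ l → l < m → m < n → ¬(l % 2 = m % 2 ∧ m % 2 = n % 2) →
    ContDiff ℝ (⊤ : ℕ∞) A → (∀ (c : ℝ) (y : E3), A (c • y) = c ^ l * A y) → (∀ y, Laplacian.laplacian A y = 0) →
    ContDiff ℝ (⊤ : ℕ∞) B → (∀ (c : ℝ) (y : E3), B (c • y) = c ^ m * B y) → (∀ y, Laplacian.laplacian B y = 0) →
    ContDiff ℝ (⊤ : ℕ∞) C → (∀ (c : ℝ) (y : E3), C (c • y) = c ^ n * C y) → (∀ y, Laplacian.laplacian C y = 0) →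
    (∃ y, A y ≠ 0) → (∃ y, B y ≠ 0) → (∃ y, C y ≠ 0) →
    (∀ x : E3, x ≠ 0 →
      horizonL1 (fun z => horizonProfile l A 0 z + horizonProfile m B 0 z + horizonProfile n C 0 z) 0 x = 0) →
    ∃ (a : E3) (gA gB gC : ℝ → ℝ), a ≠ 0 ∧
      (∀ y : E3, y ≠ 0 → A y = ‖y‖ ^ l * gA (inner ℝ a y / ‖y‖)) ∧
      (∀ y : E3, y ≠ 0 → B y = ‖y‖ ^ m * gB (inner ℝ a y / ‖y‖)) ∧
      (∀ y : E3, y ≠ 0 → C y = ‖y‖ ^ n * gC (inner ℝ a y / ‖y‖))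

/-- FINITE TOWERS WITH A COPRIME OPPOSITE-PARITY THIRD SHELL ARE DECIDED AT ORDER ONE (THM C; THEOREM
`finiteTowerOppositeParityHorizonTowerZonality`, file `Theorems/ThreadingFluxHorizonTowerFiniteTowerByNameII.lean`; kernel theorem
`finiteTower_zonalForm_of_oppositeParity`, `…FiniteTowerThirdShell`): a scale-free finite tower of horizon profiles of smooth
homogeneous harmonic shells (degrees `≥ 1`) annihilated by the order-one horizon law off the centre, whose two largest degrees
`D = max K`, `D′ = max (K ∖ {D})` have the SAME parity, whose largest degree `a` of the OTHER parity exists, with `H_D, H_{D′}, H_a ≢ 0`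
and `gcd(D, D′, a) = 1` (`Nat.Coprime D (Nat.gcd D′ a)`), is coaxially zonal.  (The pair `(a, D)` is automatically isolated in its
parity class of the order-one identity; covers e.g. `{1,2,4,6}`, `{1,3,4,8}`; contains ARM A's even–even dipole cells with `a = 1`.) -/
def FiniteTowerOppositeParityHorizonTowerZonality : Prop :=
  ∀ (K : Finset ℕ) (H : ℕ → E3 → ℝ) (hK : K.Nonempty) (hK' : (K.erase (K.max' hK)).Nonempty)
    (hKo : (K.filter fun l => l % 2 ≠ K.max' hK % 2).Nonempty), (∀ l ∈ K, 1 ≤ l) →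
    (∀ l ∈ K, ContDiff ℝ (⊤ : ℕ∞) (H l)) → (∀ l ∈ K, ∀ (c : ℝ) (y : E3), H l (c • y) = c ^ l * H l y) →
    (∀ l ∈ K, ∀ y, Laplacian.laplacian (H l) y = 0) →
    ((K.erase (K.max' hK)).max' hK') % 2 = (K.max' hK) % 2 →
    (∃ y, H (K.max' hK) y ≠ 0) → (∃ y, H ((K.erase (K.max' hK)).max' hK') y ≠ 0) →
    (∃ y, H ((K.filter fun l => l % 2 ≠ K.max' hK % 2).max' hKo) y ≠ 0) →
    Nat.Coprime (K.max' hK) (Nat.gcd ((K.erase (K.max' hK)).max' hK') ((K.filter fun l => l % 2 ≠ K.max' hK % 2).max' hKo)) →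
    (∀ x : E3, x ≠ 0 → horizonL1 (fun z => ∑ l ∈ K, horizonProfile l (H l) 0 z) 0 x = 0) →
    ∃ a : E3, a ≠ 0 ∧ ∀ l ∈ K, ∃ g : ℝ → ℝ, ∀ y : E3, y ≠ 0 → H l y = ‖y‖ ^ l * g (inner ℝ a y / ‖y‖)


/-! ## Finite towers at order one, III (ns-wall-eng-3 g5; statement only, appended): THM E (the tower `{2, 4, 6}`) -/

/-- THE TOWER `{2, 4, 6}` IS DECIDED AT ORDER ONE (THM E; THEOREM `twoFourSixHorizonTowerZonality`, file
`Theorems/ThreadingFluxHorizonTowerFiniteTowerByNameIII.lean`, closes it by name; kernel theorem `finiteTower_zonalForm_of_twoFourSix`,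
`Theorems/ThreadingFluxHorizonTowerFiniteTowerTwoFourSix.lean`): a scale-free three-shell tower `U_A + U_B + U_C`, `A ∈ 𝓗₂` (POSSIBLY
ZERO), `B ∈ 𝓗₄`, `C ∈ 𝓗₆` smooth homogeneous harmonic shells with `B, C ≢ 0`, annihilated by the order-one horizon law off the centre, is
coaxially zonal.  This is the first all-one-parity cell with a NON-COPRIME top pair (the only tower with all degrees `≤ 6` not decided by
THM A–D): the null-cone digit of the top bracket only makes the top shells the harmonic projections `c₁·π₄(L²)`, `c₂·π₆(L³)` of the powers
of ONE harmonic quadratic `L = xᵀQx`; the next two `ρ`-adic digits of the class identity `7ρ²{P₂,P₄} + 18ρ{P₂,P₆} + 11{P₄,P₆} = 0`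
force `Q² = βQ + γI`, i.e. `Q` uniaxial, so the top shell is zonal and THM A descends.  Shaped exactly like
`ThreeShellMixedParityHorizonTowerZonality` with `(l, m, n) = (2, 4, 6)` and WITHOUT the non-vanishing of `A`; with `B ≡ 0` or `C ≡ 0`
the tower has two shells and is decided by `TwoShellHorizonTowerZonality` (p691920), with `B ≡ C ≡ 0` it is a single shell (order one is
then vacuous).  BC5 non-vacuity witness: `A = 0`, `B`, `C` the zonal solid harmonics of degrees `4`, `6` about `e₃`. -/
def TwoFourSixHorizonTowerZonality : Prop :=
  ∀ (A B C : E3 → ℝ),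
    ContDiff ℝ (⊤ : ℕ∞) A → (∀ (c : ℝ) (y : E3), A (c • y) = c ^ 2 * A y) → (∀ y, Laplacian.laplacian A y = 0) →
    ContDiff ℝ (⊤ : ℕ∞) B → (∀ (c : ℝ) (y : E3), B (c • y) = c ^ 4 * B y) → (∀ y, Laplacian.laplacian B y = 0) →
    ContDiff ℝ (⊤ : ℕ∞) C → (∀ (c : ℝ) (y : E3), C (c • y) = c ^ 6 * C y) → (∀ y, Laplacian.laplacian C y = 0) →
    (∃ y, B y ≠ 0) → (∃ y, C y ≠ 0) →
    (∀ x : E3, x ≠ 0 →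
      horizonL1 (fun z => horizonProfile 2 A 0 z + horizonProfile 4 B 0 z + horizonProfile 6 C 0 z) 0 x = 0) →
    ∃ (a : E3) (gA gB gC : ℝ → ℝ), a ≠ 0 ∧
      (∀ y : E3, y ≠ 0 → A y = ‖y‖ ^ 2 * gA (inner ℝ a y / ‖y‖)) ∧
      (∀ y : E3, y ≠ 0 → B y = ‖y‖ ^ 4 * gB (inner ℝ a y / ‖y‖)) ∧
      (∀ y : E3, y ≠ 0 → C y = ‖y‖ ^ 6 * gC (inner ℝ a y / ‖y‖))


/-! ## Finite towers at order one, IV (ns-wall-eng-3 g5; statement only, appended): THM F (the tower `{2, 6, 8}`) -/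

/-- THE TOWER `{2, 6, 8}` IS DECIDED AT ORDER ONE (THM F; THEOREM `twoSixEightHorizonTowerZonality`, file
`Theorems/ThreadingFluxHorizonTowerFiniteTowerByNameIV.lean`, closes it by name; kernel theorem `finiteTower_zonalForm_of_twoSixEight`,
`Theorems/ThreadingFluxHorizonTowerFiniteTowerTwoSixEight.lean`): a scale-free three-shell tower `U_A + U_B + U_C`, `A ∈ 𝓗₂` (POSSIBLY
ZERO), `B ∈ 𝓗₆`, `C ∈ 𝓗₈` smooth homogeneous harmonic shells with `B, C ≢ 0`, annihilated by the order-one horizon law off the centre, is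
coaxially zonal.  Second all-one-parity cell with a NON-COPRIME top pair, `(6, 8) = 2·(3, 4)`: the null-cone digit makes the top shells
`c₁·π₆(L³)`, `c₂·π₈(L⁴)` for one harmonic quadratic `L = xᵀQx`; the competitors of the top pair enter the class identity
`5{P₆,P₈} + 11ρ²{P₂,P₈} + 6ρ³{P₂,P₆} = 0` only at `ρ²`, so the SECOND `ρ`-adic digit `−288288 · det(x,Qx,Q²x) · L⁴` of `{P₆, P₈}` dies on
the cone, the harmonic cubic `det(x, Qx, Q²x)` vanishes, `Q` is uniaxial, the top shell is zonal and THM A descends.  Shaped exactly like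
`TwoFourSixHorizonTowerZonality` with degrees `(2, 6, 8)`; with `B ≡ 0` or `C ≡ 0` the tower has two shells (`TwoShellHorizonTowerZonality`,
p691920).  BC5 non-vacuity witness: `A = 0`, `B`, `C` the zonal solid harmonics of degrees `6`, `8` about `e₃`. -/
def TwoSixEightHorizonTowerZonality : Prop :=
  ∀ (A B C : E3 → ℝ),
    ContDiff ℝ (⊤ : ℕ∞) A → (∀ (c : ℝ) (y : E3), A (c • y) = c ^ 2 * A y) → (∀ y, Laplacian.laplacian A y = 0) →
    ContDiff ℝ (⊤ : ℕ∞) B → (∀ (c : ℝ) (y : E3), B (c • y) = c ^ 6 * B y) → (∀ y, Laplacian.laplacian B y = 0) →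
    ContDiff ℝ (⊤ : ℕ∞) C → (∀ (c : ℝ) (y : E3), C (c • y) = c ^ 8 * C y) → (∀ y, Laplacian.laplacian C y = 0) →
    (∃ y, B y ≠ 0) → (∃ y, C y ≠ 0) →
    (∀ x : E3, x ≠ 0 →
      horizonL1 (fun z => horizonProfile 2 A 0 z + horizonProfile 6 B 0 z + horizonProfile 8 C 0 z) 0 x = 0) →
    ∃ (a : E3) (gA gB gC : ℝ → ℝ), a ≠ 0 ∧
      (∀ y : E3, y ≠ 0 → A y = ‖y‖ ^ 2 * gA (inner ℝ a y / ‖y‖)) ∧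
      (∀ y : E3, y ≠ 0 → B y = ‖y‖ ^ 6 * gB (inner ℝ a y / ‖y‖)) ∧
      (∀ y : E3, y ≠ 0 → C y = ‖y‖ ^ 8 * gC (inner ℝ a y / ‖y‖))


/-! ## Finite towers at order one, V (ns-wall-eng-3 g5; statement only, appended): THM G (the tower `{4, 6, 8}`) -/

/-- THE TOWER `{4, 6, 8}` IS DECIDED AT ORDER ONE (THM G; THEOREM `fourSixEightHorizonTowerZonality`, file
`Theorems/ThreadingFluxHorizonTowerFiniteTowerByNameV.lean`, closes it by name; kernel theorem `finiteTower_zonalForm_of_fourSixEight`,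
`Theorems/ThreadingFluxHorizonTowerFiniteTowerFourSixEight.lean`): a scale-free three-shell tower `U_A + U_B + U_C`, `A ∈ 𝓗₄` (POSSIBLY
ZERO), `B ∈ 𝓗₆`, `C ∈ 𝓗₈` smooth homogeneous harmonic shells with `B, C ≢ 0`, annihilated by the order-one horizon law off the centre, is
coaxially zonal.  Third all-one-parity cell with a NON-COPRIME top pair, and the first whose third degree `D′ − 2 = 4` COMPETES at the
second digit: after the null-cone digit (`P₆ = c₁·77π₆(L³)`, `P₈ = c₂·2145π₈(L⁴)` for one harmonic quadratic `L = xᵀQx`) the class identity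
`15{P₆,P₈} + 26ρ{P₄,P₈} + 11ρ²{P₄,P₆} = 0` confines `P₄` to the plane `⟨π₄(L²), π₄(L|Qx|²)⟩` at the second digit and forces `Q² = βQ + γI`
(uniaxial `Q`) at the third.  Shaped exactly like `TwoFourSixHorizonTowerZonality` with degrees `(4, 6, 8)`; with `B ≡ 0` or `C ≡ 0`
the tower has two shells (`TwoShellHorizonTowerZonality`, p691920).  BC5 non-vacuity witness: `A = 0`, `B`, `C` the zonal solid
harmonics of degrees `6`, `8` about `e₃`. -/
def FourSixEightHorizonTowerZonality : Prop :=
  ∀ (A B C : E3 → ℝ),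
    ContDiff ℝ (⊤ : ℕ∞) A → (∀ (c : ℝ) (y : E3), A (c • y) = c ^ 4 * A y) → (∀ y, Laplacian.laplacian A y = 0) →
    ContDiff ℝ (⊤ : ℕ∞) B → (∀ (c : ℝ) (y : E3), B (c • y) = c ^ 6 * B y) → (∀ y, Laplacian.laplacian B y = 0) →
    ContDiff ℝ (⊤ : ℕ∞) C → (∀ (c : ℝ) (y : E3), C (c • y) = c ^ 8 * C y) → (∀ y, Laplacian.laplacian C y = 0) →
    (∃ y, B y ≠ 0) → (∃ y, C y ≠ 0) →
    (∀ x : E3, x ≠ 0 →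
      horizonL1 (fun z => horizonProfile 4 A 0 z + horizonProfile 6 B 0 z + horizonProfile 8 C 0 z) 0 x = 0) →
    ∃ (a : E3) (gA gB gC : ℝ → ℝ), a ≠ 0 ∧
      (∀ y : E3, y ≠ 0 → A y = ‖y‖ ^ 4 * gA (inner ℝ a y / ‖y‖)) ∧
      (∀ y : E3, y ≠ 0 → B y = ‖y‖ ^ 6 * gB (inner ℝ a y / ‖y‖)) ∧
      (∀ y : E3, y ≠ 0 → C y = ‖y‖ ^ 8 * gC (inner ℝ a y / ‖y‖))

/-! ## Finite towers at order one, VI (ns-wall-eng-3 g5; statement only, appended): THM H (top pair with `gcd = 2`, no shell of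
degree `D′ − 2` — the SECOND CONE DIGIT in general) -/

/-- FINITE TOWERS WHOSE TOP PAIR HAS `gcd = 2` AND NO SHELL OF DEGREE `D′ − 2` ARE DECIDED AT ORDER ONE (THM H; THEOREM
`finiteTowerGcdTwoTopHorizonTowerZonality`, file `Theorems/ThreadingFluxHorizonTowerFiniteTowerByNameVI.lean`, closes it by name;
kernel theorem `finiteTower_zonalForm_of_evenPair`, `Theorems/ThreadingFluxHorizonTowerFiniteTowerEvenPair.lean`): a scale-free finite
tower of horizon profiles of smooth homogeneous harmonic shells (degrees `≥ 1`, at least two of them) annihilated by the order-one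
horizon law off the centre, whose two largest degrees `D = max K`, `D′ = max (K ∖ {D})` have `gcd(D, D′) = 2` and `D′ ≥ 4`, with
`H_D, H_{D′} ≢ 0` and NO shell of degree `D′ − 2` (`∀ l ∈ K, l + 2 ≠ D′`), is COAXIALLY ZONAL.  The infinite family behind
`TwoSixEightHorizonTowerZonality` (THM F): `{2,6,8}`, `{2,8,10}`, `{4,8,10}`, `{2,4,8,10}`, `{1,2,3,6,10}`, `{4,10,14}`, …; writing
`D′ = 2(m+2) < D = 2(n+2)` with `m+2 ⊥ n+2`, the null-cone digit of the top bracket makes `P_{D′} ≡ g₁L^{m+2}`, `P_D ≡ g₂L^{n+2}`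
`(mod ρ)` for ONE real harmonic quadratic `L = xᵀQx` (degree-two chart surjectivity + reality), the class identity has no competitor
on level `N − 2` (that would be the pair `(D′−2, D)`), so the SECOND `ρ`-adic digit `96(m+2)(n+2)(m−n)g₁g₂ · L^{m+n+1} · det(x,Qx,Q²x)`
of `(8m+14)(8n+14){P_{D′}, P_D}` dies on the cone, the harmonic cubic `det(x,Qx,Q²x)` vanishes, `{L, |Qx|²} = 0`, same-degree
rigidity makes `Q² = βQ + γI`, `Q` is uniaxial, the top shell is zonal and THM A descends.  Shaped exactly like
`FiniteTowerCoprimeTopHorizonTowerZonality` with `Nat.Coprime D D′` replaced by `Nat.gcd D D′ = 2 ∧ 4 ≤ D′ ∧ (D′ − 2 ∉ K)`; towers whose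
top pair has `gcd ≥ 3`, or `gcd = 2` WITH a shell of degree `D′ − 2` other than `{2,4,6}` / `{4,6,8}` (THM E / THM G), stay OPEN.
BC5 non-vacuity witness: `K = {6, 8}`, `H 6`, `H 8` the zonal solid harmonics about `e₃`. -/
def FiniteTowerGcdTwoTopHorizonTowerZonality : Prop :=
  ∀ (K : Finset ℕ) (H : ℕ → E3 → ℝ) (hK : K.Nonempty) (hK' : (K.erase (K.max' hK)).Nonempty), (∀ l ∈ K, 1 ≤ l) →
    (∀ l ∈ K, ContDiff ℝ (⊤ : ℕ∞) (H l)) → (∀ l ∈ K, ∀ (c : ℝ) (y : E3), H l (c • y) = c ^ l * H l y) →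
    (∀ l ∈ K, ∀ y, Laplacian.laplacian (H l) y = 0) →
    (∃ y, H (K.max' hK) y ≠ 0) → (∃ y, H ((K.erase (K.max' hK)).max' hK') y ≠ 0) →
    Nat.gcd (K.max' hK) ((K.erase (K.max' hK)).max' hK') = 2 → 4 ≤ (K.erase (K.max' hK)).max' hK' →
    (∀ l ∈ K, l + 2 ≠ (K.erase (K.max' hK)).max' hK') →
    (∀ x : E3, x ≠ 0 → horizonL1 (fun z => ∑ l ∈ K, horizonProfile l (H l) 0 z) 0 x = 0) →
    ∃ a : E3, a ≠ 0 ∧ ∀ l ∈ K, ∃ g : ℝ → ℝ, ∀ y : E3, y ≠ 0 → H l y = ‖y‖ ^ l * g (inner ℝ a y / ‖y‖)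

/-! ## Finite towers at order one, VII (ns-wall-eng-3 g5; statement only, appended): THM C′ (top pair of OPPOSITE parity with an
isolated same-parity companion — the mirror image of THM C) -/

/-- FINITE TOWERS WHOSE TOP PAIR HAS OPPOSITE PARITY AND AN ISOLATED COPRIME SAME-PARITY COMPANION ARE DECIDED AT ORDER ONE (THM C′;
THEOREM `finiteTowerOppositeParityTopHorizonTowerZonality`, file `Theorems/ThreadingFluxHorizonTowerFiniteTowerByNameVII.lean`, closes it
by name; kernel theorem `finiteTower_zonalForm_of_oppositeParityTop`, `Theorems/ThreadingFluxHorizonTowerFiniteTowerOppositeTop.lean`): a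
scale-free finite tower of horizon profiles of smooth homogeneous harmonic shells (degrees `≥ 1`) annihilated by the order-one horizon law
off the centre, whose two largest degrees `D = max K`, `D′ = max (K ∖ {D})` have OPPOSITE parity, whose largest degree `a ≠ D` of the
parity OF `D` exists, such that no two distinct shells of the parity of `D′` have degree sum `≥ a + D` (then the pair `(a, D)` is
isolated in its parity class of the order-one identity, as `(D′, D)` is in the other class), with `H_D, H_{D′}, H_a ≢ 0` and
`gcd(D, D′, a) = 1` (`Nat.Coprime D (Nat.gcd D′ a)`), is coaxially zonal.  Mirror image of `FiniteTowerOppositeParityHorizonTowerZonality`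
(THM C, where the top pair has the SAME parity and the isolation of `(a, D)` is automatic); covers `{1,2,3,6}` — the smallest tower not
decided by THM A–H — and e.g. `{2,4,5,10}`, `{1,2,3,4,9,12}`.  BC5 non-vacuity witness: `K = {1,2,3,6}`, all four shells the zonal solid
harmonics about `e₃`. -/
def FiniteTowerOppositeParityTopHorizonTowerZonality : Prop :=
  ∀ (K : Finset ℕ) (H : ℕ → E3 → ℝ) (hK : K.Nonempty) (hK' : (K.erase (K.max' hK)).Nonempty)
    (hKs : (K.filter fun l => l ≠ K.max' hK ∧ l % 2 = K.max' hK % 2).Nonempty), (∀ l ∈ K, 1 ≤ l) →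
    (∀ l ∈ K, ContDiff ℝ (⊤ : ℕ∞) (H l)) → (∀ l ∈ K, ∀ (c : ℝ) (y : E3), H l (c • y) = c ^ l * H l y) →
    (∀ l ∈ K, ∀ y, Laplacian.laplacian (H l) y = 0) →
    ((K.erase (K.max' hK)).max' hK') % 2 ≠ (K.max' hK) % 2 →
    (∀ j ∈ K, ∀ k ∈ K, j ≠ k → j % 2 ≠ K.max' hK % 2 → k % 2 ≠ K.max' hK % 2 →
      j + k < (K.filter fun l => l ≠ K.max' hK ∧ l % 2 = K.max' hK % 2).max' hKs + K.max' hK) →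
    (∃ y, H (K.max' hK) y ≠ 0) → (∃ y, H ((K.erase (K.max' hK)).max' hK') y ≠ 0) →
    (∃ y, H ((K.filter fun l => l ≠ K.max' hK ∧ l % 2 = K.max' hK % 2).max' hKs) y ≠ 0) →
    Nat.Coprime (K.max' hK)
      (Nat.gcd ((K.erase (K.max' hK)).max' hK') ((K.filter fun l => l ≠ K.max' hK ∧ l % 2 = K.max' hK % 2).max' hKs)) →
    (∀ x : E3, x ≠ 0 → horizonL1 (fun z => ∑ l ∈ K, horizonProfile l (H l) 0 z) 0 x = 0) →
    ∃ a : E3, a ≠ 0 ∧ ∀ l ∈ K, ∃ g : ℝ → ℝ, ∀ y : E3, y ≠ 0 → H l y = ‖y‖ ^ l * g (inner ℝ a y / ‖y‖)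

/-! ## Finite towers at order one, VIII (ns-wall-eng-3 g5; statement only, appended): THM C″ (top pair of OPPOSITE parity with an
isolated companion of the SECOND shell) -/

/-- FINITE TOWERS WHOSE TOP PAIR HAS OPPOSITE PARITY AND WHOSE SECOND SHELL HAS AN ISOLATED COPRIME COMPANION ARE DECIDED AT ORDER ONE
(THM C″; THEOREM `finiteTowerOppositeParityBelowHorizonTowerZonality`, file `Theorems/ThreadingFluxHorizonTowerFiniteTowerByNameVIII.lean`,
closes it by name; kernel theorem `finiteTower_zonalForm_of_oppositeParityBelow`, `Theorems/ThreadingFluxHorizonTowerFiniteTowerOppositeBelow.lean`):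
a scale-free finite tower of horizon profiles of smooth homogeneous harmonic shells (degrees `≥ 1`) annihilated by the order-one horizon law
off the centre, whose two largest degrees `D = max K`, `D′ = max (K ∖ {D})` have OPPOSITE parity, whose largest degree `b ≠ D′` of the
parity of `D′` exists, such that `a + D < b + D′` for every degree `a ≠ D` of the parity of `D` (then the pair `(b, D′)` is isolated in
its parity class of the order-one identity), with `H_D, H_{D′}, H_b ≢ 0` and `gcd(D, D′, b) = 1` (`Nat.Coprime D (Nat.gcd D′ b)`), is
coaxially zonal: the second shell is forced zonal (`f_b^{D′} ∝ f_{D′}^b`, `g^{D′} ∝ f_{D′}^D`), then the top shell (THM A′) and the tower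
(THM A).  Companion of `FiniteTowerOppositeParityTopHorizonTowerZonality` (THM C′); covers `{2,4,6,9}`, `{2,4,6,8,11}`, `{4,6,8,13}`.
BC5 non-vacuity witness: `K = {2,4,6,9}`, all shells the zonal solid harmonics about `e₃`. -/
def FiniteTowerOppositeParityBelowHorizonTowerZonality : Prop :=
  ∀ (K : Finset ℕ) (H : ℕ → E3 → ℝ) (hK : K.Nonempty) (hK' : (K.erase (K.max' hK)).Nonempty)
    (hKb : (K.filter fun l => l ≠ (K.erase (K.max' hK)).max' hK' ∧ l % 2 = (K.erase (K.max' hK)).max' hK' % 2).Nonempty),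
    (∀ l ∈ K, 1 ≤ l) →
    (∀ l ∈ K, ContDiff ℝ (⊤ : ℕ∞) (H l)) → (∀ l ∈ K, ∀ (c : ℝ) (y : E3), H l (c • y) = c ^ l * H l y) →
    (∀ l ∈ K, ∀ y, Laplacian.laplacian (H l) y = 0) →
    ((K.erase (K.max' hK)).max' hK') % 2 ≠ (K.max' hK) % 2 →
    (∀ a ∈ K, a ≠ K.max' hK → a % 2 = K.max' hK % 2 →
      a + K.max' hK < (K.filter fun l => l ≠ (K.erase (K.max' hK)).max' hK' ∧
        l % 2 = (K.erase (K.max' hK)).max' hK' % 2).max' hKb + (K.erase (K.max' hK)).max' hK') →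
    (∃ y, H (K.max' hK) y ≠ 0) → (∃ y, H ((K.erase (K.max' hK)).max' hK') y ≠ 0) →
    (∃ y, H ((K.filter fun l => l ≠ (K.erase (K.max' hK)).max' hK' ∧
      l % 2 = (K.erase (K.max' hK)).max' hK' % 2).max' hKb) y ≠ 0) →
    Nat.Coprime (K.max' hK) (Nat.gcd ((K.erase (K.max' hK)).max' hK')
      ((K.filter fun l => l ≠ (K.erase (K.max' hK)).max' hK' ∧ l % 2 = (K.erase (K.max' hK)).max' hK' % 2).max' hKb)) →
    (∀ x : E3, x ≠ 0 → horizonL1 (fun z => ∑ l ∈ K, horizonProfile l (H l) 0 z) 0 x = 0) →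
    ∃ a : E3, a ≠ 0 ∧ ∀ l ∈ K, ∃ g : ℝ → ℝ, ∀ y : E3, y ≠ 0 → H l y = ‖y‖ ^ l * g (inner ℝ a y / ‖y‖)

/-! ## Finite towers at order one, IX (ns-wall-eng-3 g5; statement only, appended): THM I (the tower `{2, 4, 6, 8}`) -/

/-- THE TOWER `{2, 4, 6, 8}` IS DECIDED AT ORDER ONE (THM I; THEOREM `twoFourSixEightHorizonTowerZonality`, file
`Theorems/ThreadingFluxHorizonTowerFiniteTowerByNameIX.lean`, closes it by name; kernel theorem `finiteTower_zonalForm_of_twoFourSixEight`,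
`Theorems/ThreadingFluxHorizonTowerFiniteTowerTwoFourSixEight.lean`): a scale-free tower `Σ_{l ∈ {2,4,6,8}} U_{H_l}` of horizon profiles of
smooth homogeneous harmonic shells of degrees `2, 4, 6, 8` (`H₂`, `H₄` POSSIBLY ZERO) with `H₆, H₈ ≢ 0`, annihilated by the order-one horizon
law off the centre, is coaxially zonal.  The smallest tower not decided by THM A–H, C′, C″: gcd-2 top pair `(6, 8)` with the competitor
shell `4 = D′ − 2` AND a second free shell `2`; digits 0–2 as in THM G confine `P₄` to the plane `⟨π₄(L²), π₄(L·|Qx|²)⟩`, and the THIRD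
digit reads `chartT L ∣ 285405120c₁c₂ · chartT W · chartT M` on the null cone, impossible off the uniaxial locus by the coprimality of the
generator charts (`Zonal.eq_zero_of_chartT_genL_dvd`); on it (`W ≡ 0`) the uniaxial lemma applies.  Stated over `K = {2,4,6,8}` in the
vocabulary of `FiniteTowerCoprimeTopHorizonTowerZonality`.  BC5 non-vacuity witness: `H₂ = H₄ = 0`, `H₆`, `H₈` the zonal solid harmonics
about `e₃`. -/
def TwoFourSixEightHorizonTowerZonality : Prop :=
  ∀ (H : ℕ → E3 → ℝ), (∀ l ∈ ({2, 4, 6, 8} : Finset ℕ), ContDiff ℝ (⊤ : ℕ∞) (H l)) →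
    (∀ l ∈ ({2, 4, 6, 8} : Finset ℕ), ∀ (c : ℝ) (y : E3), H l (c • y) = c ^ l * H l y) →
    (∀ l ∈ ({2, 4, 6, 8} : Finset ℕ), ∀ y, Laplacian.laplacian (H l) y = 0) →
    (∃ y, H 6 y ≠ 0) → (∃ y, H 8 y ≠ 0) →
    (∀ x : E3, x ≠ 0 → horizonL1 (fun z => ∑ l ∈ ({2, 4, 6, 8} : Finset ℕ), horizonProfile l (H l) 0 z) 0 x = 0) →
    ∃ a : E3, a ≠ 0 ∧ ∀ l ∈ ({2, 4, 6, 8} : Finset ℕ), ∃ g : ℝ → ℝ, ∀ y : E3, y ≠ 0 → H l y = ‖y‖ ^ l * g (inner ℝ a y / ‖y‖)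


/-! ## Finite towers at order one, X (ns-wall-eng-3 g6; statement only, appended): THM J (top pair with `gcd = 2` WITH the competitor
shell of degree `D′ − 2` — the THIRD CONE DIGIT in general) -/

/-- FINITE TOWERS WHOSE TOP PAIR HAS `gcd = 2`, WITH THE COMPETITOR SHELL OF DEGREE `D′ − 2` FREE, ARE DECIDED AT ORDER ONE (THM J;
THEOREM `finiteTowerGcdTwoCompetitorHorizonTowerZonality`, file `Theorems/ThreadingFluxHorizonTowerFiniteTowerByNameX.lean`, closes it by
name; kernel theorems `finiteTower_exists_axis_of_gcdTwoCompetitor` / `finiteTower_zonalForm_of_gcdTwoCompetitor`,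
`Theorems/ThreadingFluxHorizonTowerFiniteTowerGcdTwoCompetitor(Zonal).lean`): a scale-free finite tower of horizon profiles of smooth
homogeneous harmonic shells (degrees `≥ 1`, at least two of them) annihilated by the order-one horizon law off the centre, whose two largest
degrees `D = max K`, `D′ = max (K ∖ {D})` have `gcd(D, D′) = 2` and `D′ ≥ 4`, with `H_D, H_{D′} ≢ 0`, the COMPETITOR shell of degree
`D′ − 2` and every lower shell of either parity FREE (present or not, no condition), and no shell of degree `D′ − 4` unless that degree is
`≤ 2` (`∀ l ∈ K, l + 4 = D′ → l ≤ 2`), is COAXIALLY ZONAL.  This is `FiniteTowerGcdTwoTopHorizonTowerZonality` (THM H) with its gap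
hypothesis `∀ l ∈ K, l + 2 ≠ D′` REMOVED (replaced by the weaker condition two levels down); it contains `TwoFourSixHorizonTowerZonality`
(THM E), `FourSixEightHorizonTowerZonality` (THM G) and `TwoFourSixEightHorizonTowerZonality` (THM I) as instances and decides the infinite
families `{2,4,10}`, `{4,6,10}`, `{2,4,6,10}`, `{6,8,10}`, `{2,6,8,10}`, `{8,10,12}`, `{6,8,14}`, … (with any odd or lower shells).  Writing
`D′ = 2(m+2) < D = 2(n+2)` with `m+2 ⊥ n+2`: digits 0–1 make `P_{D′} = g₁L^{m+2} + ρG₁`, `P_D = g₂L^{n+2} + ρG₂` over ONE real harmonic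
quadratic `L = xᵀQx`; the SECOND `ρ`-adic digit of the class identity no longer concludes (the competitor `P_c`, `c = D′ − 2`, enters it) but
CONFINES the competitor, `u·P_c = κ₀L^{m+1} + κ₁L^m|Qx|² + ρG_c` (`u ≠ 0`); the THIRD digit, with every Leibniz closed form in general
degree and all denominators cleared, reads `K_M · L^{m+n+1} · |Qx|² · det(x,Qx,Q²x) ≡ L^{m+n+2}·(…) (mod ρ)` with
`K_M = 4096·c₀c₁(8m+14)(8n+14)(m+2)(n+2)²·g₁g₂²·N(m,n)`, `N(m, m+d+1) = −(d+1)(288m⁴ + 432m³d + 2016m³ + 144m²d² + 2304m²d + 5490m² +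
612md² + 4509md + 7137m + 630d² + 3150d + 3780) ≠ 0`, so on the null cone `chartT L ∣ K_M · chartT det(x,Qx,Q²x) · chartT |Qx|²`, impossible
off the uniaxial locus by the coprimality of the generator charts (`Zonal.eq_zero_of_chartT_genL_dvd`); on it the uniaxial lemma applies and
THM A descends.  (A shell of degree `D′ − 4 = 2m` enters the third digit as `L^{n+1}{P_{D′−4}, L}`, absorbed by `L^{m+n+2}` exactly when
`m ≤ 1`; for `m ≥ 2` it is confined, not excluded, and the decision moves to the fourth digit — towers with BOTH the `D′−2` and `D′−4` shells
and `m ≥ 2` (`{4,6,8,10}`, `{2,4,6,8,10}`, …), `gcd ≥ 3`, and ties stay OPEN.)  Shaped exactly like `FiniteTowerGcdTwoTopHorizonTowerZonality`.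
BC5 non-vacuity witness: `K = {4, 6, 8}`, `H 4`, `H 6`, `H 8` the zonal solid harmonics about `e₃`. -/
def FiniteTowerGcdTwoCompetitorHorizonTowerZonality : Prop :=
  ∀ (K : Finset ℕ) (H : ℕ → E3 → ℝ) (hK : K.Nonempty) (hK' : (K.erase (K.max' hK)).Nonempty), (∀ l ∈ K, 1 ≤ l) →
    (∀ l ∈ K, ContDiff ℝ (⊤ : ℕ∞) (H l)) → (∀ l ∈ K, ∀ (c : ℝ) (y : E3), H l (c • y) = c ^ l * H l y) →
    (∀ l ∈ K, ∀ y, Laplacian.laplacian (H l) y = 0) →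
    (∃ y, H (K.max' hK) y ≠ 0) → (∃ y, H ((K.erase (K.max' hK)).max' hK') y ≠ 0) →
    Nat.gcd (K.max' hK) ((K.erase (K.max' hK)).max' hK') = 2 → 4 ≤ (K.erase (K.max' hK)).max' hK' →
    (∀ l ∈ K, l + 4 = (K.erase (K.max' hK)).max' hK' → l ≤ 2) →
    (∀ x : E3, x ≠ 0 → horizonL1 (fun z => ∑ l ∈ K, horizonProfile l (H l) 0 z) 0 x = 0) →
    ∃ a : E3, a ≠ 0 ∧ ∀ l ∈ K, ∃ g : ℝ → ℝ, ∀ y : E3, y ≠ 0 → H l y = ‖y‖ ^ l * g (inner ℝ a y / ‖y‖)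

/-! ## Finite towers at order one, XI (ns-wall-eng-3 g7; statement only, appended): THM K (top pair with `gcd = 2` WITH the competitor
shell `D′ − 2` AND the shell `D′ − 4` — the FOURTH CONE DIGIT in general) -/

/-- FINITE TOWERS WHOSE TOP PAIR HAS `gcd = 2`, WITH THE SHELLS OF DEGREES `D′ − 2` AND `D′ − 4` FREE, ARE DECIDED AT ORDER ONE (THM K;
THEOREM `finiteTowerGcdTwoTwoShellsHorizonTowerZonality`, file `Theorems/ThreadingFluxHorizonTowerFiniteTowerByNameXI.lean`, closes it by
name; kernel theorems `finiteTower_exists_axis_of_gcdTwoTwoShells` / `finiteTower_zonalForm_of_gcdTwoTwoShells`,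
`Theorems/ThreadingFluxHorizonTowerFiniteTowerGcdTwoTwoShells(Zonal).lean`): a scale-free finite tower of horizon profiles of smooth
homogeneous harmonic shells (degrees `≥ 1`, at least two of them) annihilated by the order-one horizon law off the centre, whose two largest
degrees `D = max K`, `D′ = max (K ∖ {D})` have `gcd(D, D′) = 2` and `D′ ≥ 8`, with `H_D, H_{D′} ≢ 0`, the shells of degrees `D′ − 2`
(the competitor) and `D′ − 4` and every EVEN shell of degree `≤ D′ − 8` FREE (present or not, no condition), no shell of degree `D′ − 6`
unless `D′ ≤ 10`
(`∀ l ∈ K, l + 6 = D′ → D′ ≤ 10`), and no two ODD shells of degree sum `D + D′ − 6` (`∀ j k ∈ K, j, k odd → j + k + 6 ≠ D + D′`; automatic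
unless `D = D′ + 2`, where it excludes only the pair `(D′ − 3, D′ − 1)` — towers with an odd shell are the business of THM C,
`FiniteTowerOppositeParityHorizonTowerZonality`), is COAXIALLY ZONAL.  This is `FiniteTowerGcdTwoCompetitorHorizonTowerZonality` (THM J)
one cone digit deeper: THM J's hypothesis «no shell of degree `D′ − 4` unless that degree is `≤ 2`» is REMOVED for `D′ ≥ 8` (replaced by the
two weaker conditions three levels down); it decides `{4,6,8,10}`, `{2,4,6,8,10}`, `{6,8,10,12}`, `{2,6,8,10,12}`, `{4,6,8,10,12}`,
`{2,4,6,8,10,12}` (all six residual `gcd = 2` towers of degrees `≤ 12`) and the infinite families `{2(m+2)−4, 2(m+2)−2, 2(m+2), 2(n+2)}`,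
`m + 2 ⊥ n + 2`, `2 ≤ m < n` (with any lower even shells, and the `D′ − 6` shell when `m ≤ 3`).  Writing `D′ = 2(m+2) < D = 2(n+2)`: digits
0–1 make `P_{D′} = g₁L^{m+2} + ρG₁`, `P_D = g₂L^{n+2} + ρG₂` over ONE real harmonic quadratic `L = xᵀQx` (THM H); digit 2 CONFINES the
competitor, `u·P_c = κ₀L^{m+1} + κ₁L^m|Qx|² + ρG_c` (THM J); digit 3 no longer concludes (the shell `P_b`, `b = D′ − 4`, enters it as
`L^{n+1}{P_b, L}`) but CONFINES `P_b` with a source: `v·P_b = K_M·L^{m−2}|Qx|⁴ + 2Z_W·L^{m−1}|Qx|² + γL^m + ρG_b` (the digit-3 coefficient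
`K_M ≠ 0` of THM J is now the leading coefficient of the free shell); the FOURTH digit, with every Leibniz closed form in general degree
(third-order harmonic remainders, `Δ²(L^m|Qx|²)`, `∇|Qx|²·∇|Qx|² = 2τ|Qx|² + 4δL`) and all denominators cleared, reads
`K₂₂ · L^{m+n−3} · |Qx|⁴ · det(x,Qx,Q²x) ≡ L^{m+n−2}·(…) (mod ρ)` with `K₂₂` a product of non-zero factors times
`N₄(m,n) = 48m⁴n² + 192m³n³ + 144m²n⁴ + 96m⁴n + 648m³n² + 320m²n³ + 1304mn⁴ + 45m⁴ + 618m³n − 1425m²n² + 7314mn³ + 512n⁴ + 180m³ − 4248m²n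
+ 14496mn² + 2884n³ − 2680m² + 11948mn + 5868n² + 3480m + 5096n + 1600`, and `N₄(m, m+d+1)` has all 25 coefficients positive, so on the
null cone `chartT L ∣ K₂₂ · chartT det(x,Qx,Q²x) · (chartT |Qx|²)²`, impossible off the uniaxial locus by the coprimality of the generator
charts; on it the uniaxial lemma applies and THM A descends.  (A shell of degree `D′ − 6` enters the fourth digit as `L^{n+1}{P_{D′−6}, L}`,
absorbed exactly when `m ≤ 3`; for `m ≥ 4` it is confined and the decision moves to digit 5 — each further free even shell costs one digit;
`gcd ≥ 3` and ties stay OPEN.)  Shaped exactly like `FiniteTowerGcdTwoCompetitorHorizonTowerZonality`.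
BC5 non-vacuity witness: `K = {4, 6, 8, 10}`, `H 4`, `H 6`, `H 8`, `H 10` the zonal solid harmonics about `e₃`. -/
def FiniteTowerGcdTwoTwoShellsHorizonTowerZonality : Prop :=
  ∀ (K : Finset ℕ) (H : ℕ → E3 → ℝ) (hK : K.Nonempty) (hK' : (K.erase (K.max' hK)).Nonempty), (∀ l ∈ K, 1 ≤ l) →
    (∀ l ∈ K, ContDiff ℝ (⊤ : ℕ∞) (H l)) → (∀ l ∈ K, ∀ (c : ℝ) (y : E3), H l (c • y) = c ^ l * H l y) →
    (∀ l ∈ K, ∀ y, Laplacian.laplacian (H l) y = 0) →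
    (∃ y, H (K.max' hK) y ≠ 0) → (∃ y, H ((K.erase (K.max' hK)).max' hK') y ≠ 0) →
    Nat.gcd (K.max' hK) ((K.erase (K.max' hK)).max' hK') = 2 → 8 ≤ (K.erase (K.max' hK)).max' hK' →
    (∀ l ∈ K, l + 6 = (K.erase (K.max' hK)).max' hK' → (K.erase (K.max' hK)).max' hK' ≤ 10) →
    (∀ j ∈ K, ∀ k ∈ K, Odd j → Odd k → j + k + 6 ≠ K.max' hK + (K.erase (K.max' hK)).max' hK') →
    (∀ x : E3, x ≠ 0 → horizonL1 (fun z => ∑ l ∈ K, horizonProfile l (H l) 0 z) 0 x = 0) →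
    ∃ a : E3, a ≠ 0 ∧ ∀ l ∈ K, ∃ g : ℝ → ℝ, ∀ y : E3, y ≠ 0 → H l y = ‖y‖ ^ l * g (inner ℝ a y / ‖y‖)

end Summit.NavierStokesRegularity.NavierStokesRegularity.Theorems.PoloidalLiouville.HorizonTower

end
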